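import Mathlib
import HarnessLib
import Literature.Computability.AlgebraicComplexity.PatternExpressions
import Literature.Computability.AlgebraicComplexity.ValiantClasses
import Summits.ValiantsHypothesis.ValiantsHypothesis.Theorems.MonotoneRestorationOrbitCompressionQPShortClose

/-!
# Route MonotoneRestoration — aside `OrbitCompressionQP` (stmt-ValiantsHypothesis-18332), line
# `expression_compression`: the FLOORS of `stub_narrowExpressionCompression`, length bound included

The second stub of `Cruxes/OrbitCompressionQP/Lines/expression_compression.lean` asks, for a matrix-symmetric
`VP` family presented by closed labelled pattern expressions with polylogarithmically many labels, for such
presentations of quasi-polynomial LENGTH: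
`∃ c, ∀ n ≥ 1, ∃ k l (e : PatternExpr ℂ k l), n^{k+l} ≤ 2^{(log₂ n + c)^c} ∧ |e| ≤ 2^{(log₂ n + c)^c} ∧ e.close n = f n`.
It is the open, `VP`-load-bearing half of the aside (false without `VP`:
`NarrowCompressionFalseWithoutVP.not_narrowExpressionCompression_without_VP`, witness: power-type orbit sums on
ONE row and ONE column).  This file proves that conclusion — verbatim, length bound included — on the two
strata where no idea is needed, through the length-tracking machine
`ShortClose.exists_short_close_of_matrixSymmetric / _of_rows_cols_le`, and records which hypothesis carries each:

* `narrowCompression_of_polylogDegree` — FLOOR 1 (VP-free, presentation-free): every matrix-symmetric family of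
  degree `≤ (log₂ n + c)^c` satisfies the conclusion of `stub_narrowExpressionCompression` (`d + d` labels,
  length `≤ (d+1)^{d²}(2d³+4)+1`, both quasi-polynomial);
* `narrowCompression_of_rowColSparse` — FLOOR 2: every matrix-symmetric family whose monomials each use
  `≤ (log₂ n + c)^c` rows and columns and whose degree is quasi-polynomially bounded satisfies it; the DEGREE
  bound is load-bearing (the no-`VP` counterexample above is `1`-row-`1`-column sparse of exponential degree),
  and `narrowCompression_of_rowColSparse_VP` takes it from `IsVPFamily` (p-family ⇒ p-bounded degree; the
  circuit half of `VP` is idle on this stratum);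
* quasi-polynomial arithmetic: `polylog_master` (anything `≤ ((log₂ n + c)^c + log₂ n + 2)^k` is
  `≤ (log₂ n + c')^{c'}`), `labels_qp`, `length_qp`, `pbounded_le_qp`.

Through THEOREM ζ-P (`Theorems.qpSymmetric_patternExpr`, one line, not restated here to keep this file out of
the route file's import cone) each floor gives the conclusion of the aside itself (square-symmetric circuits of
quasi-polynomial SIZE) on its stratum.  Above these floors (polynomial degree with monomials on unboundedly many
rows or columns) the stub is the open problem recorded on the item.  Helper file (`--supports stmt-ValiantsHypothesis-18332`); def-free; nothing here
is a named fact; VP ≠ VNP is not moved.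
-/

noncomputable section

open MvPolynomial

-- `Summit.ValiantsHypothesis.ValiantsHypothesis.…` is the tree's single-conjunct layout (Sub = Summit).
set_option linter.dupNamespace false

namespace Summit.ValiantsHypothesis.ValiantsHypothesis.Theorems

namespace CompressionFloors

open Literature.Computability.AlgebraicComplexity ShortClose

/-! ### Quasi-polynomial arithmetic -/

section Arithmetic

/-- Master bound: anything `≤ ((log₂ n + c)^c + log₂ n + 2)^k` is `≤ (log₂ n + c')^{c'}` for a constant
`c'` depending on `c, k` only. [folklore] -/
theorem polylog_master (c k : ℕ) : ∃ c' : ℕ, ∀ L X : ℕ, X ≤ ((L + c) ^ c + L + 2) ^ k → X ≤ (L + c') ^ c' := by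
  refine ⟨(c + 1) * k + c + 3, fun L X hX => ?_⟩
  have hβ : (L + c) ^ c + L + 2 ≤ (L + c + 3) ^ (c + 1) := by
    rcases Nat.eq_zero_or_pos c with rfl | hc
    · norm_num
      omega
    · have h1 : (L + c) ^ c ≤ (L + c + 3) ^ c := Nat.pow_le_pow_left (by omega) c
      have h2 : L + c + 3 ≤ (L + c + 3) ^ c := by
        calc L + c + 3 = (L + c + 3) ^ 1 := (pow_one _).symm
          _ ≤ (L + c + 3) ^ c := Nat.pow_le_pow_right (by omega) hc
      calc (L + c) ^ c + L + 2 ≤ (L + c + 3) ^ c + (L + c + 3) ^ c := by omega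
        _ = 2 * (L + c + 3) ^ c := by ring
        _ ≤ (L + c + 3) * (L + c + 3) ^ c := Nat.mul_le_mul_right _ (by omega)
        _ = (L + c + 3) ^ (c + 1) := by rw [pow_succ]; ring
  calc X ≤ ((L + c) ^ c + L + 2) ^ k := hX
    _ ≤ ((L + c + 3) ^ (c + 1)) ^ k := Nat.pow_le_pow_left hβ k
    _ = (L + c + 3) ^ ((c + 1) * k) := by rw [← pow_mul]
    _ ≤ (L + ((c + 1) * k + c + 3)) ^ ((c + 1) * k) := Nat.pow_le_pow_left (by omega) _
    _ ≤ (L + ((c + 1) * k + c + 3)) ^ ((c + 1) * k + c + 3) :=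
        Nat.pow_le_pow_right (by omega) (by omega)

/-- Label bookkeeping: `n^{d+d} ≤ 2^{(log₂ n + c')^{c'}}` whenever `d ≤ (log₂ n + c)^c`. [folklore] -/
theorem labels_qp (c : ℕ) : ∃ c' : ℕ, ∀ n d : ℕ, d ≤ (Nat.log 2 n + c) ^ c →
    n ^ (d + d) ≤ 2 ^ ((Nat.log 2 n + c') ^ c') := by
  obtain ⟨c', hc'⟩ := polylog_master c 3
  refine ⟨c', fun n d hd => ?_⟩
  have hL : n < 2 ^ (Nat.log 2 n + 1) := Nat.lt_pow_succ_log_self Nat.one_lt_two n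
  generalize Nat.log 2 n = L at hL hd hc' ⊢
  set β : ℕ := (L + c) ^ c + L + 2 with hβ
  have hdβ : d ≤ β := by omega
  have hLβ : L + 1 ≤ β := by omega
  have hexp : (L + 1) * (d + d) ≤ β ^ 3 := by
    calc (L + 1) * (d + d) ≤ β * (β + β) := Nat.mul_le_mul hLβ (by omega)
      _ = 2 * β ^ 2 := by ring
      _ ≤ β * β ^ 2 := Nat.mul_le_mul_right _ (by omega)
      _ = β ^ 3 := by ring
  calc n ^ (d + d) ≤ (2 ^ (L + 1)) ^ (d + d) := Nat.pow_le_pow_left hL.le _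
    _ = 2 ^ ((L + 1) * (d + d)) := by rw [← pow_mul]
    _ ≤ 2 ^ ((L + c') ^ c') := Nat.pow_le_pow_right (by norm_num) (hc' L _ (hexp))

/-- Length bookkeeping for the sparse floor: `(d+1)^{r·r} (2 r² d + 4) + 1 ≤ 2^{(log₂ n + c')^{c'}}` whenever
`r ≤ (log₂ n + c)^c` and `d ≤ 2^{(log₂ n + c)^c}`. [folklore] -/
theorem length_qp (c : ℕ) : ∃ c' : ℕ, ∀ n r d : ℕ, r ≤ (Nat.log 2 n + c) ^ c →
    d ≤ 2 ^ ((Nat.log 2 n + c) ^ c) →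
    (d + 1) ^ (r * r) * (2 * (r * r * d) + 4) + 1 ≤ 2 ^ ((Nat.log 2 n + c') ^ c') := by
  obtain ⟨c', hc'⟩ := polylog_master c 4
  refine ⟨c', fun n r d hr hd => ?_⟩
  generalize Nat.log 2 n = L at hr hd hc' ⊢
  set M : ℕ := (L + c) ^ c with hM
  set β : ℕ := (L + c) ^ c + L + 2 with hβ
  have hMβ : M ≤ β := by omega
  have hrβ : r ≤ β := hr.trans hMβ
  have hM1 : 1 ≤ M := by
    rcases Nat.eq_zero_or_pos c with rfl | hc
    · simp [hM]
    · exact Nat.one_le_pow _ _ (by omega)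
  have hβ3 : 3 ≤ β := by omega
  -- `d + 1 ≤ 2^(M+1)`
  have hd1 : d + 1 ≤ 2 ^ (M + 1) := by
    have : 1 ≤ 2 ^ M := Nat.one_le_two_pow
    rw [pow_succ]; omega
  -- first factor
  have hA : (d + 1) ^ (r * r) ≤ 2 ^ ((M + 1) * (r * r)) := by
    calc (d + 1) ^ (r * r) ≤ (2 ^ (M + 1)) ^ (r * r) := Nat.pow_le_pow_left hd1 _
      _ = 2 ^ ((M + 1) * (r * r)) := by rw [← pow_mul]
  -- second factor
  have hrr : r * r ≤ 2 ^ (r * r) := (Nat.lt_two_pow_self).le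
  have hB : 2 * (r * r * d) + 4 ≤ 2 ^ (r * r + M + 3) := by
    have h1 : r * r * d ≤ 2 ^ (r * r) * 2 ^ M := Nat.mul_le_mul hrr hd
    have h2 : 2 ^ (r * r + M + 3) = 2 ^ (r * r) * 2 ^ M * 8 := by
      rw [pow_add, pow_add]; norm_num
    have h3 : 1 ≤ 2 ^ (r * r) * 2 ^ M := Nat.one_le_iff_ne_zero.2 (by positivity)
    omega
  have hexp : (M + 1) * (r * r) + (r * r + M + 3) + 1 ≤ β ^ 4 := by
    have e1 : (M + 1) * (r * r) ≤ (β + 1) * (β * β) := Nat.mul_le_mul (by omega) (Nat.mul_le_mul hrβ hrβ)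
    have e2 : r * r ≤ β * β := Nat.mul_le_mul hrβ hrβ
    have e3 : (β + 1) * (β * β) + (β * β + β + 3) + 1 ≤ β ^ 4 := by
      have f1 : β + 4 ≤ β * β := by nlinarith
      have f2 : β + 3 ≤ β * β := by nlinarith
      calc (β + 1) * (β * β) + (β * β + β + 3) + 1
          ≤ (β + 1) * (β * β) + (β * β + β * β) := by omega
        _ = (β + 3) * (β * β) := by ring
        _ ≤ (β * β) * (β * β) := Nat.mul_le_mul_right _ f2
        _ = β ^ 4 := by ring
    omega
  calc (d + 1) ^ (r * r) * (2 * (r * r * d) + 4) + 1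
      ≤ 2 ^ ((M + 1) * (r * r)) * 2 ^ (r * r + M + 3) + 1 := by
        have := Nat.mul_le_mul hA hB; omega
    _ = 2 ^ ((M + 1) * (r * r) + (r * r + M + 3)) + 1 := by rw [← pow_add]
    _ ≤ 2 ^ ((M + 1) * (r * r) + (r * r + M + 3) + 1) := by
        rw [pow_succ]; have : 1 ≤ 2 ^ ((M + 1) * (r * r) + (r * r + M + 3)) := Nat.one_le_two_pow; omega
    _ ≤ 2 ^ (β ^ 4) := Nat.pow_le_pow_right (by norm_num) hexp
    _ ≤ 2 ^ ((L + c') ^ c') := Nat.pow_le_pow_right (by norm_num) (hc' L _ le_rfl)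

/-- A polylogarithmic quantity is quasi-polynomially bounded: `(log₂ n + c)^c ≤ 2^{(log₂ n + c)^c}`. [folklore] -/
theorem polylog_le_qp (n c : ℕ) : (Nat.log 2 n + c) ^ c ≤ 2 ^ ((Nat.log 2 n + c) ^ c) :=
  (Nat.lt_two_pow_self).le

/-- A p-bounded quantity is quasi-polynomially bounded: `n^a + a ≤ 2^{(log₂ n + (a+1))^{a+1}}`. [folklore] -/
theorem pbounded_le_qp (n a : ℕ) : n ^ a + a ≤ 2 ^ ((Nat.log 2 n + (a + 1)) ^ (a + 1)) := by
  have hL : n < 2 ^ (Nat.log 2 n + 1) := Nat.lt_pow_succ_log_self Nat.one_lt_two n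
  generalize Nat.log 2 n = L at hL ⊢
  have h1 : n ^ a ≤ 2 ^ ((L + 1) * a) := by
    calc n ^ a ≤ (2 ^ (L + 1)) ^ a := Nat.pow_le_pow_left hL.le a
      _ = 2 ^ ((L + 1) * a) := by rw [← pow_mul]
  have h2 : a ≤ 2 ^ a := (Nat.lt_two_pow_self).le
  have h3 : 2 ^ ((L + 1) * a) + 2 ^ a ≤ 2 ^ ((L + 1) * a + a + 1) := by
    have e1 : 2 ^ ((L + 1) * a) ≤ 2 ^ ((L + 1) * a + a) := Nat.pow_le_pow_right (by norm_num) (by omega)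
    have e2 : 2 ^ a ≤ 2 ^ ((L + 1) * a + a) := Nat.pow_le_pow_right (by norm_num) (by omega)
    rw [pow_succ]; omega
  have h4 : (L + 1) * a + a + 1 ≤ (L + (a + 1)) ^ (a + 1) := by
    have hb : 1 ≤ L + (a + 1) := by omega
    calc (L + 1) * a + a + 1 = (L + 2) * a + 1 := by ring
      _ ≤ (L + (a + 1)) * (L + (a + 1)) ^ a := by
          rcases Nat.eq_zero_or_pos a with rfl | ha
          · simp
          · have : a + 1 ≤ (L + (a + 1)) ^ a := by
              calc a + 1 ≤ L + (a + 1) := by omega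
                _ = (L + (a + 1)) ^ 1 := (pow_one _).symm
                _ ≤ (L + (a + 1)) ^ a := Nat.pow_le_pow_right hb ha
            nlinarith
      _ = (L + (a + 1)) ^ (a + 1) := by rw [pow_succ]; ring
  calc n ^ a + a ≤ 2 ^ ((L + 1) * a) + 2 ^ a := by omega
    _ ≤ 2 ^ ((L + 1) * a + a + 1) := h3
    _ ≤ 2 ^ ((L + (a + 1)) ^ (a + 1)) := Nat.pow_le_pow_right (by norm_num) h4

/-- Monotonicity of the polylogarithmic scale in the constant. [folklore] -/
theorem polylog_mono {L c c' : ℕ} (h : c ≤ c') : (L + c) ^ c ≤ (L + c') ^ c' := by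
  rcases Nat.eq_zero_or_pos c' with hc' | hc'
  · subst hc'
    obtain rfl : c = 0 := by omega
    simp
  · calc (L + c) ^ c ≤ (L + c') ^ c := Nat.pow_le_pow_left (by omega) c
      _ ≤ (L + c') ^ c' := Nat.pow_le_pow_right (by omega) h

end Arithmetic

/-! ### Floor 1: polylogarithmic degree (VP-free, hypothesis-free) -/

/-- **FLOOR 1 of `stub_narrowExpressionCompression` — polylogarithmic degree.**  Every matrix-symmetric family
of total degree `≤ (log₂ n + c)^c` satisfies, with NO `VP`, circuit or presentation hypothesis, the
conclusion of `stub_narrowExpressionCompression` of line `expression_compression` verbatim: closed labelled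
pattern expressions with polylogarithmically many labels AND quasi-polynomial length. [folklore] -/
theorem narrowCompression_of_polylogDegree (f : (n : ℕ) → MvPolynomial (Fin n × Fin n) ℂ)
    (hsymm : ∀ (n : ℕ) (σ τ : Equiv.Perm (Fin n)),
      rename (fun p : Fin n × Fin n => (σ p.1, τ p.2)) (f n) = f n)
    (hdeg : ∃ c : ℕ, ∀ n : ℕ, (f n).totalDegree ≤ (Nat.log 2 n + c) ^ c) :
    ∃ c : ℕ, ∀ n : ℕ, 1 ≤ n → ∃ (k l : ℕ) (e : PatternExpr ℂ k l),
      n ^ (k + l) ≤ 2 ^ ((Nat.log 2 n + c) ^ c) ∧ e.length ≤ 2 ^ ((Nat.log 2 n + c) ^ c) ∧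
      e.close n = f n := by
  obtain ⟨c, hc⟩ := hdeg
  obtain ⟨c₁, hc₁⟩ := labels_qp c
  obtain ⟨c₂, hc₂⟩ := length_qp c
  refine ⟨max c₁ c₂, fun n hn => ?_⟩
  set d : ℕ := (Nat.log 2 n + c) ^ c with hd
  obtain ⟨e, hlen, hclose⟩ := exists_short_close_of_matrixSymmetric hn (f n) (hsymm n) (hc n)
  exact ⟨d, d, e, (hc₁ n d le_rfl).trans (Nat.pow_le_pow_right Nat.two_pos (polylog_mono (le_max_left _ _))),
    hlen.trans ((hc₂ n d d le_rfl (polylog_le_qp n c)).trans (Nat.pow_le_pow_right Nat.two_pos (polylog_mono (le_max_right _ _)))), hclose⟩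

/-! ### Floor 2: row/column-sparse families of quasi-polynomially bounded degree -/

/-- **FLOOR 2 of `stub_narrowExpressionCompression` — row/column-sparse families.**  A matrix-symmetric family
all of whose monomials use `≤ (log₂ n + c)^c` rows and `≤ (log₂ n + c)^c` columns, and whose total degree is
quasi-polynomially bounded, satisfies the conclusion of `stub_narrowExpressionCompression` verbatim.  The
degree bound is load-bearing: the tree's no-`VP` counterexample
(`NarrowCompressionFalseWithoutVP.not_narrowExpressionCompression_without_VP`) is `1`-row-`1`-column sparse.
[folklore] -/
theorem narrowCompression_of_rowColSparse (f : (n : ℕ) → MvPolynomial (Fin n × Fin n) ℂ)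
    (hsymm : ∀ (n : ℕ) (σ τ : Equiv.Perm (Fin n)),
      rename (fun p : Fin n × Fin n => (σ p.1, τ p.2)) (f n) = f n)
    (hdeg : ∃ c : ℕ, ∀ n : ℕ, (f n).totalDegree ≤ 2 ^ ((Nat.log 2 n + c) ^ c))
    (hsparse : ∃ c : ℕ, ∀ n : ℕ, ∀ D ∈ (f n).support,
      (D.support.image Prod.fst).card ≤ (Nat.log 2 n + c) ^ c ∧
      (D.support.image Prod.snd).card ≤ (Nat.log 2 n + c) ^ c) :
    ∃ c : ℕ, ∀ n : ℕ, 1 ≤ n → ∃ (k l : ℕ) (e : PatternExpr ℂ k l),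
      n ^ (k + l) ≤ 2 ^ ((Nat.log 2 n + c) ^ c) ∧ e.length ≤ 2 ^ ((Nat.log 2 n + c) ^ c) ∧
      e.close n = f n := by
  obtain ⟨a, ha⟩ := hdeg
  obtain ⟨b, hb⟩ := hsparse
  -- one common constant for the sparsity and the degree scale
  set c : ℕ := max a b with hcdef
  obtain ⟨c₁, hc₁⟩ := labels_qp c
  obtain ⟨c₂, hc₂⟩ := length_qp c
  refine ⟨max c₁ c₂, fun n hn => ?_⟩
  set r : ℕ := (Nat.log 2 n + c) ^ c with hr
  have hbr : (Nat.log 2 n + b) ^ b ≤ r := polylog_mono (le_max_right a b)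
  obtain ⟨e, hlen, hclose⟩ := exists_short_close_of_rows_cols_le hn (f n) (hsymm n) (r := r) (s := r)
    (d := 2 ^ ((Nat.log 2 n + c) ^ c))
    (fun D hD => ((hb n D hD).1).trans hbr) (fun D hD => ((hb n D hD).2).trans hbr)
    ((ha n).trans (Nat.pow_le_pow_right Nat.two_pos (polylog_mono (le_max_left a b))))
  exact ⟨r, r, e, (hc₁ n r le_rfl).trans (Nat.pow_le_pow_right Nat.two_pos (polylog_mono (le_max_left _ _))),
    hlen.trans ((hc₂ n r _ le_rfl le_rfl).trans (Nat.pow_le_pow_right Nat.two_pos (polylog_mono (le_max_right _ _)))), hclose⟩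

/-- **FLOOR 2 for `VP` families**: a matrix-symmetric `VP` family all of whose monomials use
`≤ (log₂ n + c)^c` rows and columns satisfies the conclusion of `stub_narrowExpressionCompression` (the
p-family half of `IsVPFamily` supplies the degree bound; the circuit half is idle on this stratum). [folklore] -/
theorem narrowCompression_of_rowColSparse_VP (f : (n : ℕ) → MvPolynomial (Fin n × Fin n) ℂ)
    (hsymm : ∀ (n : ℕ) (σ τ : Equiv.Perm (Fin n)),
      rename (fun p : Fin n × Fin n => (σ p.1, τ p.2)) (f n) = f n)
    (hVP : IsVPFamily f)
    (hsparse : ∃ c : ℕ, ∀ n : ℕ, ∀ D ∈ (f n).support,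
      (D.support.image Prod.fst).card ≤ (Nat.log 2 n + c) ^ c ∧
      (D.support.image Prod.snd).card ≤ (Nat.log 2 n + c) ^ c) :
    ∃ c : ℕ, ∀ n : ℕ, 1 ≤ n → ∃ (k l : ℕ) (e : PatternExpr ℂ k l),
      n ^ (k + l) ≤ 2 ^ ((Nat.log 2 n + c) ^ c) ∧ e.length ≤ 2 ^ ((Nat.log 2 n + c) ^ c) ∧
      e.close n = f n := by
  obtain ⟨a, ha⟩ := hVP.1.2
  exact narrowCompression_of_rowColSparse f hsymm ⟨a + 1, fun n => (ha n).trans (pbounded_le_qp n a)⟩ hsparse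

end CompressionFloors

end Summit.ValiantsHypothesis.ValiantsHypothesis.Theorems

end
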